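import Literature.NumberTheory.ComplexMultiplication.EllipticUnits.KatoUnitRepIndependence
import HarnessLib

/-!
# `ι(𝒪_K) ⊂ ℂ` IS a period lattice for an imaginary quadratic `K` — and hence so is every `ι(𝔪)`, `𝔪 ≠ 0`
# (de Shalit II.1.1 / II.2.3: "let `L` be a lattice with `𝒪_K`-multiplication", Kato (15.3.1): the CM pair `(ℂ/𝔤, 1 mod 𝔤)`)

Topic `Literature/NumberTheory/ComplexMultiplication/EllipticUnits` (namespace = path).  The files of this unit quantify over
period pairs `L : PeriodPair` with `L.lattice = ι(𝔤)` (`∀ z, z ∈ L.lattice ↔ ∃ a ∈ 𝔤, z = ι a`) and several consumers carry the EXISTENCE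
of one such pair as a displayed hypothesis (`hLat₀` of the cell's (β5) chain, `hL₀` of `EllipticUnitsLocal.exists_forall_isThetaValueOne`).
THIS file discharges it unconditionally: for `K` imaginary quadratic (`[K:ℚ] = 2`, totally complex) and ANY embedding `ι : K → ℂ`,

* ★ `exists_periodPair_mem_iff_top` — **there is a period pair with lattice `ι(𝒪_K)`**: the images `ω₀, ω₁` of a `ℤ`-basis of `𝒪_K`
  (Mathlib `NumberField.RingOfIntegers.basis`, rank `2`) are `ℝ`-linearly independent — otherwise `ω₁ = rω₀` with `r ∈ ℝ`, every
  `ι(a)`, `a ∈ 𝒪_K`, is a real multiple of `ω₀`, so `ω₀ = ι(b₀²)/ω₀ ∈ ℝ`, `ι(𝒪_K) ⊂ ℝ`, `ι(K) = Frac ⊂ ℝ`, contradicting total complexity;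
* ★ `exists_periodPair_mem_iff_ideal` — **for every `𝔪 ≠ 0` a period pair with lattice `ι(𝔪)`** (down from `ι(𝒪_K)` by the tree's
  `PeriodPair.exists_lattice_eq_of_le` with `c = ι(m)`, `0 ≠ m ∈ 𝔪`).

Everything proved; no definitions, no named facts, no `sorry`.

## References
* [deShalit1987] E. de Shalit, *Iwasawa theory of elliptic curves with complex multiplication* (1987), II.1.1 (p. 31–32), II.2.3 (10) (p. 42).
* [Silverman1994] J. H. Silverman, *Advanced Topics in the Arithmetic of Elliptic Curves* (1994), Ch. II §1.1 Cor. 1.5.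
* [Kato2004Asterisque] K. Kato, Astérisque 295 (2004), §15.3 (15.3.1) (p. 252).
-/

noncomputable section

open _root_.NumberField _root_.IsDedekindDomain Complex

namespace Literature.NumberTheory.ComplexMultiplication.EllipticUnits

open Literature.NumberTheory.EllipticCurves (IsImaginaryQuadratic)

variable {K : Type} [Field K] [NumberField K]

omit [NumberField K] in
/-- Coordinates of an integer in a `ℤ`-basis indexed by a type in bijection with `Fin 2`: `a = c₀•b₀ + c₁•b₁`. [folklore] -/
private theorem eq_add_of_basis_two {ιdx : Type*} [Fintype ιdx] [DecidableEq ιdx] (b : Module.Basis ιdx ℤ (𝓞 K))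
    (e : ιdx ≃ Fin 2) (a : 𝓞 K) :
    a = b.repr a (e.symm 0) • b (e.symm 0) + b.repr a (e.symm 1) • b (e.symm 1) := by
  conv_lhs => rw [← b.sum_repr a]
  rw [← Equiv.sum_comp e.symm (fun i ↦ b.repr a i • b i), Fin.sum_univ_two]

/-- ★ **`ι(𝒪_K)` is a period lattice** for `K` imaginary quadratic and any embedding `ι : K → ℂ`: there is a `PeriodPair` whose lattice is
`{ι(a) : a ∈ 𝒪_K}`. [cite: deShalit1987, II.1.1 (p. 31), II.2.3 (10) (p. 42)] [cite: Silverman1994, Ch. II §1.1 Cor. 1.5] -/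
theorem exists_periodPair_mem_iff_top (hK : IsImaginaryQuadratic K) (ι : K →+* ℂ) :
    ∃ P : PeriodPair, ∀ z : ℂ, z ∈ P.lattice ↔ ∃ a ∈ (⊤ : Ideal (𝓞 K)), z = ι (a : K) := by
  classical
  haveI : IsTotallyComplex K := hK.2
  set b := RingOfIntegers.basis K with hb
  have hcard : Fintype.card (Module.Free.ChooseBasisIndex ℤ (𝓞 K)) = 2 := by
    rw [← Module.finrank_eq_card_basis b, RingOfIntegers.rank, hK.1]
  obtain ⟨e⟩ : Nonempty (Module.Free.ChooseBasisIndex ℤ (𝓞 K) ≃ Fin 2) := ⟨Fintype.equivFinOfCardEq hcard⟩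
  set ω₀ : ℂ := ι ((b (e.symm 0) : 𝓞 K) : K) with hω₀
  set ω₁ : ℂ := ι ((b (e.symm 1) : 𝓞 K) : K) with hω₁
  -- every `ι(a)`, `a ∈ 𝒪_K`, is `c₀ ω₀ + c₁ ω₁`
  have hrepr : ∀ a : 𝓞 K, ι (a : K) = (b.repr a (e.symm 0) : ℂ) * ω₀ + (b.repr a (e.symm 1) : ℂ) * ω₁ := by
    intro a
    have h := congrArg (fun y : 𝓞 K ↦ ι (y : K)) (eq_add_of_basis_two b e a)
    rw [h]
    push_cast [zsmul_eq_mul]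
    simp only [RingOfIntegers.coe_eq_algebraMap, map_intCast]
    rw [map_add, map_mul, map_mul, map_intCast, map_intCast]
  have hω₀0 : ω₀ ≠ 0 := by
    rw [hω₀, map_ne_zero ι, ne_eq, RingOfIntegers.coe_eq_zero_iff]
    exact b.ne_zero _
  -- `ω₀, ω₁` are `ℝ`-independent
  have hind : LinearIndependent ℝ ![ω₀, ω₁] := by
    refine (LinearIndependent.pair_iff' hω₀0).mpr fun r hr ↦ ?_
    rw [Complex.real_smul] at hr
    -- every `ι(a)` is a real multiple of `ω₀`
    have hreal : ∀ a : 𝓞 K, ∃ q : ℝ, ι (a : K) = (q : ℂ) * ω₀ := fun a ↦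
      ⟨(b.repr a (e.symm 0) : ℝ) + (b.repr a (e.symm 1) : ℝ) * r, by rw [hrepr a, ← hr]; push_cast; ring⟩
    -- `ω₀ = ι(b₀²)/ω₀` is real
    obtain ⟨q₀, hq₀⟩ := hreal (b (e.symm 0) * b (e.symm 0))
    have hω₀q : ω₀ = (q₀ : ℂ) := by
      have h1 : ι (((b (e.symm 0) * b (e.symm 0) : 𝓞 K) : K)) = ω₀ * ω₀ := by push_cast; rw [map_mul]
      rw [h1] at hq₀
      exact mul_right_cancel₀ hω₀0 hq₀
    -- hence `ι(𝒪_K) ⊂ ℝ` and `ι(K) ⊂ ℝ`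
    have him : ∀ a : 𝓞 K, (ι (a : K)).im = 0 := fun a ↦ by
      obtain ⟨q, hq⟩ := hreal a
      rw [hq, hω₀q, ← Complex.ofReal_mul, Complex.ofReal_im]
    have him' : ∀ a : 𝓞 K, ι (algebraMap (𝓞 K) K a) = ((ι (algebraMap (𝓞 K) K a)).re : ℂ) := fun a ↦
      Complex.ext (by rw [Complex.ofReal_re]) (by rw [Complex.ofReal_im]; exact him a)
    have himK : ∀ x : K, (ι x).im = 0 := fun x ↦ by
      obtain ⟨a, c, -, rfl⟩ := IsFractionRing.div_surjective (A := 𝓞 K) x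
      rw [map_div₀, him' a, him' c, ← Complex.ofReal_div, Complex.ofReal_im]
    have hreal' : ComplexEmbedding.IsReal ι :=
      ComplexEmbedding.isReal_iff.mpr (RingHom.ext fun x ↦ by
        rw [ComplexEmbedding.conjugate_coe_eq, Complex.conj_eq_iff_im, himK x])
    exact IsTotallyComplex.complexEmbedding_not_isReal ι hreal'
  refine ⟨⟨ω₀, ω₁, hind⟩, fun z ↦ ?_⟩
  rw [PeriodPair.mem_lattice]
  constructor
  · rintro ⟨m, n, rfl⟩
    refine ⟨m • b (e.symm 0) + n • b (e.symm 1), Submodule.mem_top, ?_⟩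
    push_cast [zsmul_eq_mul]
    simp only [RingOfIntegers.coe_eq_algebraMap, map_intCast]
    rw [map_add, map_mul, map_mul, map_intCast, map_intCast]
  · rintro ⟨a, -, rfl⟩
    exact ⟨b.repr a (e.symm 0), b.repr a (e.symm 1), (hrepr a).symm⟩

/-- ★ **Every `ι(𝔪)`, `𝔪 ≠ 0`, is a period lattice** (`K` imaginary quadratic): from `ι(𝒪_K)` down to `ι(𝔪)` — the sublattice `ι(𝔪) ⊆ ι(𝒪_K)`
contains `ι(m)·ι(𝒪_K)` for `0 ≠ m ∈ 𝔪` (`PeriodPair.exists_lattice_eq_of_le`). This is the displayed input «a period pair with lattice `ι(𝔪)`»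
of the theta-value files, discharged. [cite: deShalit1987, II.2.3 (10) (p. 42)] [cite: Silverman1994, Ch. II §1.1 Cor. 1.5] -/
theorem exists_periodPair_mem_iff_ideal (hK : IsImaginaryQuadratic K) (ι : K →+* ℂ) {𝔪 : Ideal (𝓞 K)} (h𝔪 : 𝔪 ≠ ⊥) :
    ∃ P : PeriodPair, ∀ z : ℂ, z ∈ P.lattice ↔ ∃ a ∈ 𝔪, z = ι (a : K) := by
  obtain ⟨P₀, hP₀⟩ := exists_periodPair_mem_iff_top hK ι
  -- the target lattice `ι(𝔪)` as a `ℤ`-submodule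
  let f : 𝓞 K →+ ℂ := ι.toAddMonoidHom.comp (algebraMap (𝓞 K) K).toAddMonoidHom
  let Λ' : Submodule ℤ ℂ := (𝔪.toAddSubgroup.map f).toIntSubmodule
  have hΛ' : ∀ z : ℂ, z ∈ Λ' ↔ ∃ a ∈ 𝔪, z = ι (a : K) := by
    intro z
    change z ∈ 𝔪.toAddSubgroup.map f ↔ _
    rw [AddSubgroup.mem_map]
    constructor
    · rintro ⟨a, ha, rfl⟩; exact ⟨a, ha, rfl⟩
    · rintro ⟨a, ha, rfl⟩; exact ⟨a, ha, rfl⟩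
  obtain ⟨m, hm, hm0⟩ := Submodule.exists_mem_ne_zero_of_ne_bot h𝔪
  have hc0 : ι (m : K) ≠ 0 := (map_ne_zero ι).mpr (RingOfIntegers.coe_ne_zero_iff.mpr hm0)
  -- `ι(m)·ι(𝒪_K) ⊆ ι(𝔪) ⊆ ι(𝒪_K)`: scale `P₀` by `ι(m)` and go up to `ι(𝔪)`
  let P₁ : PeriodPair := P₀.mulLeft (ι (m : K)) hc0
  have hP₁ : P₁.lattice ≤ Λ' := by
    intro z hz
    rw [PeriodPair.mem_mulLeft_lattice, hP₀] at hz
    obtain ⟨a, -, ha⟩ := hz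
    rw [hΛ']
    refine ⟨m * a, 𝔪.mul_mem_right a hm, ?_⟩
    have e1 : z = ι (m : K) * ((ι (m : K))⁻¹ * z) := by rw [← mul_assoc, mul_inv_cancel₀ hc0, one_mul]
    rw [e1, ha]
    push_cast
    rw [map_mul]
  have hmul : ∀ z ∈ Λ', ι (m : K) * z ∈ P₁.lattice := by
    intro z hz
    obtain ⟨a, -, rfl⟩ := (hΛ' z).mp hz
    rw [PeriodPair.mem_mulLeft_lattice, ← mul_assoc, inv_mul_cancel₀ hc0, one_mul, hP₀]
    exact ⟨a, Submodule.mem_top, rfl⟩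
  obtain ⟨P, hP⟩ := P₁.exists_lattice_eq_of_le hP₁ hc0 hmul
  exact ⟨P, fun z ↦ by rw [hP]; exact hΛ' z⟩

end Literature.NumberTheory.ComplexMultiplication.EllipticUnits

end
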